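import Mathlib.Analysis.InnerProductSpace.Calculus
import Mathlib.Analysis.Convex.Deriv
import Mathlib.Analysis.Calculus.ContDiff.RCLike
import Mathlib.Analysis.Calculus.MeanValue
import HarnessLib

/-!
# Images of small balls under `C²` diffeomorphisms are convex

The analytic lemma behind the existence of GOOD COVERS by chart balls without any Riemannian
geometry: if `τ` is a `C²` diffeomorphism between open subsets of a finite-dimensional real inner
product space, with inverse `g`, then the image `τ(B(c, r))` of every sufficiently small ball is
CONVEX, with a radius bound uniform on compact sets. Indeed `τ(B(c, r)) = {y : ‖g y - c‖ < r}`
near `τ c`, and the function `y ↦ ‖g y - c‖²` has second derivative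
`2‖Dg(y)v‖² + 2⟪g y - c, D²g(y)[v,v]⟫ ≥ 2(σ² - m C)‖v‖² > 0` as soon as `‖g y - c‖ ≤ m` is small
against the injectivity constant `σ` of `Dg` and the bound `C` of `D²g` (this is the classical
remark that small geodesic = Euclidean balls are strongly convex, e.g. M. Berger, *Geometry I*
(1987), 11.1.3; for the use in the construction of good covers cf. R. Bott, L. W. Tu,
*Differential Forms in Algebraic Topology* (1982), Thm. 5.1, where geodesically convex balls are
used instead).

* `convexOn_norm_sub_sq` — the Hessian estimate: convexity of `y ↦ ‖g y - w‖²` on a convex open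
  set where `σ‖v‖ ≤ ‖Dg v‖`, `‖D²g‖ ≤ C`, `‖g - w‖ ≤ m` and `m C ≤ σ²` (proved along lines with
  Mathlib's `convexOn_of_deriv2_nonneg`);
* `convex_image_ball_of_bounds` — consequently `τ(B(c,r))` is convex whenever it is the sublevel
  set `{y ∈ S | ‖g y - c‖ < r}` of such a function on a convex open `S`.

The uniform-on-compacts packaging and the manifold application (finite chart-convex covers of
compact manifolds) are in the de Rham theorem files. No named facts; everything is proved.

## References

* R. Bott, L. W. Tu, *Differential Forms in Algebraic Topology*, GTM 82, Springer 1982, §5,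
  Thm. 5.1 (good covers). [BottTu1982Forms]
-/

noncomputable section

open Set Filter Metric RealInnerProductSpace
open scoped Topology InnerProductSpace

namespace Literature.Analysis.Convexity

variable {V : Type*} [NormedAddCommGroup V] [InnerProductSpace ℝ V]

/-! ### The Hessian estimate along a line -/

/-- **Second derivative of `t ↦ ‖g(y₀ + t v) - w‖²`** at a point of the open set where `g` is
`C²`: it is `2 (‖Dg(y)v‖² + ⟪g y - w, D²g(y)[v, v]⟫)`, `y = y₀ + t v`. [folklore] -/
theorem hasDerivAt_deriv_norm_sub_sq {g : V → V} {Ω : Set V} (hΩ : IsOpen Ω)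
    (hg : ContDiffOn ℝ 2 g Ω) (y₀ v w : V) {t : ℝ} (ht : y₀ + t • v ∈ Ω) :
    HasDerivAt (fun s ↦ ‖g (y₀ + s • v) - w‖ ^ 2)
      (2 * ⟪g (y₀ + t • v) - w, fderiv ℝ g (y₀ + t • v) v⟫) t ∧
    (∀ᶠ s in 𝓝 t, deriv (fun s ↦ ‖g (y₀ + s • v) - w‖ ^ 2) s =
      2 * ⟪g (y₀ + s • v) - w, fderiv ℝ g (y₀ + s • v) v⟫) ∧
    HasDerivAt (fun s ↦ 2 * ⟪g (y₀ + s • v) - w, fderiv ℝ g (y₀ + s • v) v⟫)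
      (2 * (⟪g (y₀ + t • v) - w, fderiv ℝ (fderiv ℝ g) (y₀ + t • v) v v⟫ +
        ⟪fderiv ℝ g (y₀ + t • v) v, fderiv ℝ g (y₀ + t • v) v⟫)) t := by
  -- the line and its derivative
  set ℓ : ℝ → V := fun s ↦ y₀ + s • v with hℓ
  have hℓd : ∀ s, HasDerivAt ℓ v s := fun s ↦ by
    have h := ((hasDerivAt_id s).smul_const v).const_add y₀
    simpa [hℓ] using h
  have hℓc : Continuous ℓ := (continuous_const.add (continuous_id.smul continuous_const))
  -- `g` and `Dg` are differentiable at the points of `Ω`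
  have hg1 : DifferentiableOn ℝ g Ω := hg.differentiableOn (by norm_num)
  have hg2 : ContDiffOn ℝ 1 (fderiv ℝ g) Ω := hg.fderiv_of_isOpen hΩ (by norm_num)
  have hg2d : DifferentiableOn ℝ (fderiv ℝ g) Ω := hg2.differentiableOn (by norm_num)
  have hG : ∀ s, ℓ s ∈ Ω → HasDerivAt (fun s ↦ g (ℓ s) - w) (fderiv ℝ g (ℓ s) v) s := fun s hs ↦
    ((hg1.hasFDerivAt (hΩ.mem_nhds hs)).comp_hasDerivAt s (hℓd s)).sub_const w
  have hφ : ∀ s, ℓ s ∈ Ω → HasDerivAt (fun s ↦ ‖g (ℓ s) - w‖ ^ 2)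
      (2 * ⟪g (ℓ s) - w, fderiv ℝ g (ℓ s) v⟫) s := fun s hs ↦ (hG s hs).norm_sq
  refine ⟨hφ t ht, ?_, ?_⟩
  · -- `deriv φ = φ₁` near `t` (the set of `s` with `ℓ s ∈ Ω` is open)
    have hopen : IsOpen {s : ℝ | ℓ s ∈ Ω} := hΩ.preimage hℓc
    filter_upwards [hopen.mem_nhds ht] with s hs
    exact (hφ s hs).deriv
  · -- derivative of `φ₁`
    have hA : HasDerivAt (fun s ↦ fderiv ℝ g (ℓ s) v)
        (fderiv ℝ (fderiv ℝ g) (ℓ t) v v) t := by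
      have h1 : HasDerivAt (fun s ↦ fderiv ℝ g (ℓ s)) (fderiv ℝ (fderiv ℝ g) (ℓ t) v) t :=
        (hg2d.hasFDerivAt (hΩ.mem_nhds ht)).comp_hasDerivAt t (hℓd t)
      have h2 := h1.clm_apply (hasDerivAt_const t v)
      simpa using h2
    have h := ((hG t ht).inner ℝ hA).const_mul 2
    exact h

/-- **Convexity of `y ↦ ‖g y - w‖²` from bounds on `Dg`, `D²g` and `g - w`** (the Hessian
`2‖Dg v‖² + 2⟪g - w, D²g[v,v]⟫` is `≥ 2(σ² - mC)‖v‖² ≥ 0`): for `g` of class `C²` on an open `Ω`,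
a convex open `S ⊆ Ω`, and constants with `σ ‖v‖ ≤ ‖Dg(y) v‖`, `‖D²g(y)‖ ≤ C`, `‖g y - w‖ ≤ m`
on `S` and `m C ≤ σ²`, the function is convex on `S`. [folklore] -/
theorem convexOn_norm_sub_sq {g : V → V} {Ω : Set V} (hΩ : IsOpen Ω) (hg : ContDiffOn ℝ 2 g Ω)
    {S : Set V} (hS : Convex ℝ S) (hSo : IsOpen S) (hSΩ : S ⊆ Ω) (w : V) {σ C m : ℝ}
    (hσ0 : 0 ≤ σ) (hσ : ∀ y ∈ S, ∀ v : V, σ * ‖v‖ ≤ ‖fderiv ℝ g y v‖)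
    (hC : ∀ y ∈ S, ‖fderiv ℝ (fderiv ℝ g) y‖ ≤ C) (hm : ∀ y ∈ S, ‖g y - w‖ ≤ m)
    (hmC : m * C ≤ σ ^ 2) : ConvexOn ℝ S fun y ↦ ‖g y - w‖ ^ 2 := by
  refine ⟨hS, fun y₀ hy₀ y₁ hy₁ a b ha hb hab ↦ ?_⟩
  set v := y₁ - y₀ with hv
  set φ : ℝ → ℝ := fun s ↦ ‖g (y₀ + s • v) - w‖ ^ 2 with hφdef
  set D : Set ℝ := {s | y₀ + s • v ∈ S} with hD
  have hℓc : Continuous fun s : ℝ ↦ y₀ + s • v :=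
    continuous_const.add (continuous_id.smul continuous_const)
  have hDo : IsOpen D := hSo.preimage hℓc
  have hDc : Convex ℝ D := by
    intro s hs s' hs' a' b' ha' hb' hab'
    have h := hS hs hs' ha' hb' hab'
    have e : a' • (y₀ + s • v) + b' • (y₀ + s' • v) = y₀ + (a' • s + b' • s') • v := by
      rw [smul_add, smul_add, add_smul, ← add_assoc, add_right_comm (a' • y₀), ← add_smul, hab',
        one_smul, add_assoc, smul_smul, smul_smul, smul_eq_mul, smul_eq_mul]
    rw [e] at h
    exact h
  have h0D : (0 : ℝ) ∈ D := by simpa [hD] using hy₀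
  have h1D : (1 : ℝ) ∈ D := by
    show y₀ + (1 : ℝ) • v ∈ S
    rw [one_smul, hv, add_sub_cancel]
    exact hy₁
  -- derivatives on `D`
  have key : ∀ t ∈ D, HasDerivAt φ (2 * ⟪g (y₀ + t • v) - w, fderiv ℝ g (y₀ + t • v) v⟫) t ∧
      (∀ᶠ s in 𝓝 t, deriv φ s = 2 * ⟪g (y₀ + s • v) - w, fderiv ℝ g (y₀ + s • v) v⟫) ∧
      HasDerivAt (fun s ↦ 2 * ⟪g (y₀ + s • v) - w, fderiv ℝ g (y₀ + s • v) v⟫)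
        (2 * (⟪g (y₀ + t • v) - w, fderiv ℝ (fderiv ℝ g) (y₀ + t • v) v v⟫ +
          ⟪fderiv ℝ g (y₀ + t • v) v, fderiv ℝ g (y₀ + t • v) v⟫)) t :=
    fun t ht ↦ hasDerivAt_deriv_norm_sub_sq hΩ hg y₀ v w (hSΩ ht)
  have hconv : ConvexOn ℝ D φ := by
    refine convexOn_of_deriv2_nonneg hDc ?_ ?_ ?_ ?_
    · exact fun t ht ↦ (key t ht).1.continuousAt.continuousWithinAt
    · rw [hDo.interior_eq]
      exact fun t ht ↦ (key t ht).1.differentiableAt.differentiableWithinAt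
    · rw [hDo.interior_eq]
      intro t ht
      have h := (key t ht).2.2.differentiableAt
      exact (h.congr_of_eventuallyEq (key t ht).2.1).differentiableWithinAt
    · rw [hDo.interior_eq]
      intro t ht
      have hderiv2 : deriv^[2] φ t = 2 * (⟪g (y₀ + t • v) - w, fderiv ℝ (fderiv ℝ g) (y₀ + t • v) v v⟫ +
          ⟪fderiv ℝ g (y₀ + t • v) v, fderiv ℝ g (y₀ + t • v) v⟫) := by
        rw [Function.iterate_succ_apply, Function.iterate_one,
          Filter.EventuallyEq.deriv_eq (show deriv φ =ᶠ[𝓝 t] _ from (key t ht).2.1)]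
        exact (key t ht).2.2.deriv
      rw [hderiv2]
      have hy : y₀ + t • v ∈ S := ht
      -- the two estimates
      have h1 : σ ^ 2 * ‖v‖ ^ 2 ≤ ⟪fderiv ℝ g (y₀ + t • v) v, fderiv ℝ g (y₀ + t • v) v⟫ := by
        rw [real_inner_self_eq_norm_sq, ← mul_pow]
        exact pow_le_pow_left₀ (mul_nonneg hσ0 (norm_nonneg _)) (hσ _ hy v) 2
      have h2 : -(m * C * ‖v‖ ^ 2) ≤ ⟪g (y₀ + t • v) - w, fderiv ℝ (fderiv ℝ g) (y₀ + t • v) v v⟫ := by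
        have hcs := abs_real_inner_le_norm (g (y₀ + t • v) - w) (fderiv ℝ (fderiv ℝ g) (y₀ + t • v) v v)
        have hb : ‖fderiv ℝ (fderiv ℝ g) (y₀ + t • v) v v‖ ≤ C * ‖v‖ ^ 2 := by
          calc ‖fderiv ℝ (fderiv ℝ g) (y₀ + t • v) v v‖
              ≤ ‖fderiv ℝ (fderiv ℝ g) (y₀ + t • v) v‖ * ‖v‖ := ContinuousLinearMap.le_opNorm _ _
            _ ≤ (‖fderiv ℝ (fderiv ℝ g) (y₀ + t • v)‖ * ‖v‖) * ‖v‖ := by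
                gcongr
                exact ContinuousLinearMap.le_opNorm _ _
            _ ≤ (C * ‖v‖) * ‖v‖ := by gcongr; exact hC _ hy
            _ = C * ‖v‖ ^ 2 := by ring
        have hprod : ‖g (y₀ + t • v) - w‖ * ‖fderiv ℝ (fderiv ℝ g) (y₀ + t • v) v v‖ ≤ m * C * ‖v‖ ^ 2 := by
          calc ‖g (y₀ + t • v) - w‖ * ‖fderiv ℝ (fderiv ℝ g) (y₀ + t • v) v v‖
              ≤ m * (C * ‖v‖ ^ 2) := mul_le_mul (hm _ hy) hb (norm_nonneg _)
                  ((norm_nonneg _).trans (hm _ hy))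
            _ = m * C * ‖v‖ ^ 2 := by ring
        have := (abs_le.1 hcs).1
        linarith
      have h3 : m * C * ‖v‖ ^ 2 ≤ σ ^ 2 * ‖v‖ ^ 2 := mul_le_mul_of_nonneg_right hmC (sq_nonneg _)
      nlinarith
  -- evaluate the convexity inequality of `φ` at `0`, `1`
  have h := hconv.2 h0D h1D ha hb hab
  have e0 : φ 0 = ‖g y₀ - w‖ ^ 2 := by simp [hφdef]
  have e1 : φ 1 = ‖g y₁ - w‖ ^ 2 := by simp [hφdef, hv]
  have eab : φ (a • (0 : ℝ) + b • 1) = ‖g (a • y₀ + b • y₁) - w‖ ^ 2 := by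
    have : y₀ + (a • (0 : ℝ) + b • 1) • v = a • y₀ + b • y₁ := by
      rw [smul_zero, zero_add, smul_eq_mul, mul_one, hv, smul_sub]
      have ha' : a = 1 - b := by linarith
      rw [ha', sub_smul, one_smul]
      abel
    simp only [hφdef, this]
  rw [eab, e0, e1] at h
  exact h

/-! ### Convex images of small balls -/

/-- **Sublevel sets of the convex function on a convex open set are convex**: with the bounds of
`convexOn_norm_sub_sq` on a convex open `S`, `{y ∈ S | ‖g y - w‖ < r}` is convex for every `r`.
[folklore] -/
theorem convex_sublevel_norm_sub {g : V → V} {Ω : Set V} (hΩ : IsOpen Ω) (hg : ContDiffOn ℝ 2 g Ω)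
    {S : Set V} (hS : Convex ℝ S) (hSo : IsOpen S) (hSΩ : S ⊆ Ω) (w : V) {σ C m : ℝ}
    (hσ0 : 0 ≤ σ) (hσ : ∀ y ∈ S, ∀ v : V, σ * ‖v‖ ≤ ‖fderiv ℝ g y v‖)
    (hC : ∀ y ∈ S, ‖fderiv ℝ (fderiv ℝ g) y‖ ≤ C) (hm : ∀ y ∈ S, ‖g y - w‖ ≤ m)
    (hmC : m * C ≤ σ ^ 2) {r : ℝ} (hr : 0 ≤ r) :
    Convex ℝ {y ∈ S | ‖g y - w‖ < r} := by
  have h := (convexOn_norm_sub_sq hΩ hg hS hSo hSΩ w hσ0 hσ hC hm hmC).convex_lt (r ^ 2)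
  convert h using 1
  ext y
  simp only [mem_setOf_eq]
  exact and_congr_right fun _ ↦ (pow_lt_pow_iff_left₀ (norm_nonneg _) hr two_ne_zero).symm

omit [InnerProductSpace ℝ V] in
/-- **The image of a ball under a local inverse is a sublevel set**: if `τ` and `g` are mutually
inverse between `D` and `D' = τ '' D`, `c ∈ D`, the ball `ball c r ⊆ D` and its image lies in a
set `S ⊆ D'`, then `τ '' ball c r = {y ∈ S | ‖g y - c‖ < r}`. [folklore] -/
theorem image_ball_eq_sublevel {τ g : V → V} {D S : Set V} {c : V} {r : ℝ}
    (hgτ : ∀ x ∈ D, g (τ x) = x) (hτg : ∀ y ∈ S, τ (g y) = y)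
    (hBD : ball c r ⊆ D) (hτB : τ '' ball c r ⊆ S) :
    τ '' ball c r = {y ∈ S | ‖g y - c‖ < r} := by
  ext y
  constructor
  · rintro ⟨x, hx, rfl⟩
    refine ⟨hτB ⟨x, hx, rfl⟩, ?_⟩
    rw [hgτ x (hBD hx), ← dist_eq_norm]
    exact hx
  · rintro ⟨hyS, hy⟩
    refine ⟨g y, ?_, hτg y hyS⟩
    rw [mem_ball, dist_eq_norm]
    exact hy

/-- **Images of small balls under `C²` local diffeomorphisms are convex** (pointwise form): with
`τ ∘ g = id` on `S`, `g ∘ τ = id` on `D` (`g` of class `C²` on the open `Ω ⊇ S`), the bounds of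
`convexOn_norm_sub_sq` on a convex open `S` for `w = c = g (τ c)`, `ball c r ⊆ D` and
`τ '' ball c r ⊆ S`, the image `τ '' ball c r` is convex. [folklore] -/
theorem convex_image_ball_of_bounds {τ g : V → V} {Ω D S : Set V} (hΩ : IsOpen Ω)
    (hg : ContDiffOn ℝ 2 g Ω) (hS : Convex ℝ S) (hSo : IsOpen S) (hSΩ : S ⊆ Ω) {c : V} {σ C m : ℝ}
    (hσ0 : 0 ≤ σ) (hσ : ∀ y ∈ S, ∀ v : V, σ * ‖v‖ ≤ ‖fderiv ℝ g y v‖)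
    (hC : ∀ y ∈ S, ‖fderiv ℝ (fderiv ℝ g) y‖ ≤ C) (hm : ∀ y ∈ S, ‖g y - c‖ ≤ m)
    (hmC : m * C ≤ σ ^ 2) {r : ℝ} (hr : 0 ≤ r)
    (hgτ : ∀ x ∈ D, g (τ x) = x) (hτg : ∀ y ∈ S, τ (g y) = y)
    (hBD : ball c r ⊆ D) (hτB : τ '' ball c r ⊆ S) :
    Convex ℝ (τ '' ball c r) := by
  rw [image_ball_eq_sublevel hgτ hτg hBD hτB]
  exact convex_sublevel_norm_sub hΩ hg hS hSo hSΩ c hσ0 hσ hC hm hmC hr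

/-! ### Uniform radius on compact sets -/

/-- `‖v‖ ≤ ‖Dτ(g y)‖ ‖Dg(y) v‖` from `τ ∘ g = id` near `y` (chain rule). [folklore] -/
theorem norm_le_norm_fderiv_mul {τ g : V → V} {D D' : Set V} (hD : IsOpen D) (hD' : IsOpen D')
    (hτ : DifferentiableOn ℝ τ D) (hg : DifferentiableOn ℝ g D') (hgD : MapsTo g D' D)
    (hτg : ∀ y ∈ D', τ (g y) = y) {y : V} (hy : y ∈ D') (v : V) :
    ‖v‖ ≤ ‖fderiv ℝ τ (g y)‖ * ‖fderiv ℝ g y v‖ := by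
  have h1 : HasFDerivAt (τ ∘ g) ((fderiv ℝ τ (g y)).comp (fderiv ℝ g y)) y :=
    (hτ.hasFDerivAt (hD.mem_nhds (hgD hy))).comp y (hg.hasFDerivAt (hD'.mem_nhds hy))
  have h2 : HasFDerivAt (τ ∘ g) (ContinuousLinearMap.id ℝ V) y := by
    have heq : (τ ∘ g) =ᶠ[𝓝 y] id := by
      filter_upwards [hD'.mem_nhds hy] with z hz
      exact hτg z hz
    exact (hasFDerivAt_id y).congr_of_eventuallyEq heq
  have h3 := h1.unique h2
  have h4 : (fderiv ℝ τ (g y)) (fderiv ℝ g y v) = v := by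
    have := congrArg (fun L : V →L[ℝ] V ↦ L v) h3
    simpa using this
  calc ‖v‖ = ‖(fderiv ℝ τ (g y)) (fderiv ℝ g y v)‖ := by rw [h4]
    _ ≤ ‖fderiv ℝ τ (g y)‖ * ‖fderiv ℝ g y v‖ := ContinuousLinearMap.le_opNorm _ _

section Uniform

variable [FiniteDimensional ℝ V]

/-- **Images of small balls under `C²` diffeomorphisms are convex, uniformly on compact sets**:
for `τ : D → D'` a `C²` map between open sets of a finite-dimensional inner product space with
`C²` inverse `g : D' → D`, and a compact `K ⊆ D`, there is `ρ₀ > 0` such that for every `c ∈ K`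
and `0 < r ≤ ρ₀` the ball `B(c, r)` lies in `D` and its image `τ(B(c, r))` is convex (cf. the
strong convexity of small balls, and Bott–Tu (1982), Thm. 5.1). [cite: BottTu1982Forms, Thm. 5.1] -/
theorem exists_radius_convex_image_ball {τ g : V → V} {D D' : Set V} (hD : IsOpen D)
    (hD' : IsOpen D') (hτ : ContDiffOn ℝ 2 τ D) (hg : ContDiffOn ℝ 2 g D') (hτD : MapsTo τ D D')
    (hgD : MapsTo g D' D) (hgτ : ∀ x ∈ D, g (τ x) = x) (hτg : ∀ y ∈ D', τ (g y) = y)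
    {K : Set V} (hK : IsCompact K) (hKD : K ⊆ D) :
    ∃ ρ₀ > 0, ∀ c ∈ K, ∀ r, 0 < r → r ≤ ρ₀ → ball c r ⊆ D ∧ Convex ℝ (τ '' ball c r) := by
  have hτ1 : DifferentiableOn ℝ τ D := hτ.differentiableOn (by norm_num)
  have hg1 : DifferentiableOn ℝ g D' := hg.differentiableOn (by norm_num)
  have hτc : ContinuousOn τ D := hτ1.continuousOn
  -- compact neighbourhoods `K₁ = cthickening δ₁ K ⊆ D`, `K₂ = cthickening δ₂ (τ '' K₁) ⊆ D'`
  obtain ⟨δ₁, hδ₁, hK₁D⟩ := hK.exists_cthickening_subset_open hD hKD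
  set K₁ := cthickening δ₁ K with hK₁
  have hK₁c : IsCompact K₁ := hK.cthickening
  have hK'c : IsCompact (τ '' K₁) := hK₁c.image_of_continuousOn (hτc.mono hK₁D)
  have hK'D : τ '' K₁ ⊆ D' := by
    rintro _ ⟨x, hx, rfl⟩
    exact hτD (hK₁D hx)
  obtain ⟨δ₂, hδ₂, hK₂D⟩ := hK'c.exists_cthickening_subset_open hD' hK'D
  set K₂ := cthickening δ₂ (τ '' K₁) with hK₂
  have hK₂c : IsCompact K₂ := hK'c.cthickening
  -- bounds: `‖Dτ‖ ≤ A` on `K₁`, `‖Dg‖ ≤ L` and `‖D²g‖ ≤ C` on `K₂`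
  have hτ'c : ContinuousOn (fderiv ℝ τ) D := hτ.continuousOn_fderiv_of_isOpen hD (by norm_num)
  have hg'c : ContinuousOn (fderiv ℝ g) D' := hg.continuousOn_fderiv_of_isOpen hD' (by norm_num)
  have hg2 : ContDiffOn ℝ 1 (fderiv ℝ g) D' := hg.fderiv_of_isOpen hD' (by norm_num)
  have hg''c : ContinuousOn (fderiv ℝ (fderiv ℝ g)) D' :=
    hg2.continuousOn_fderiv_of_isOpen hD' (by norm_num)
  obtain ⟨A₀, hA₀⟩ := hK₁c.exists_bound_of_continuousOn (hτ'c.mono hK₁D)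
  obtain ⟨L₀, hL₀⟩ := hK₂c.exists_bound_of_continuousOn (hg'c.mono hK₂D)
  obtain ⟨C₀, hC₀⟩ := hK₂c.exists_bound_of_continuousOn (E := V →L[ℝ] V →L[ℝ] V) (hg''c.mono hK₂D)
  set A := max A₀ 1 with hA
  set L := max L₀ 1 with hL
  set C := max C₀ 1 with hC
  have hA1 : 1 ≤ A := le_max_right _ _
  have hL1 : 1 ≤ L := le_max_right _ _
  have hC1 : 1 ≤ C := le_max_right _ _
  have hApos : 0 < A := by linarith
  have hLpos : 0 < L := by linarith
  have hCpos : 0 < C := by linarith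
  have hAb : ∀ x ∈ K₁, ‖fderiv ℝ τ x‖ ≤ A := fun x hx ↦ (hA₀ x hx).trans (le_max_left _ _)
  have hLb : ∀ y ∈ K₂, ‖fderiv ℝ g y‖ ≤ L := fun y hy ↦ (hL₀ y hy).trans (le_max_left _ _)
  have hCb : ∀ y ∈ K₂, ‖fderiv ℝ (fderiv ℝ g) y‖ ≤ C := fun y hy ↦ (hC₀ y hy).trans (le_max_left _ _)
  -- the radii: `ρ` in the target, `ρ₀` in the source
  set ρ := min δ₂ (min (δ₁ / L) (1 / (A ^ 2 * C * L))) with hρ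
  have hρpos : 0 < ρ := by
    refine lt_min hδ₂ (lt_min (div_pos hδ₁ hLpos) ?_)
    exact div_pos one_pos (by positivity)
  have hρδ₂ : ρ ≤ δ₂ := min_le_left _ _
  have hρδ₁ : L * ρ ≤ δ₁ := by
    have : ρ ≤ δ₁ / L := (min_le_right _ _).trans (min_le_left _ _)
    rwa [le_div_iff₀ hLpos, mul_comm] at this
  have hρσ : L * ρ * C ≤ (1 / A) ^ 2 := by
    have h : ρ ≤ 1 / (A ^ 2 * C * L) := (min_le_right _ _).trans (min_le_right _ _)
    rw [le_div_iff₀ (by positivity)] at h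
    rw [div_pow, one_pow, le_div_iff₀ (by positivity)]
    nlinarith
  refine ⟨min δ₁ (ρ / A), lt_min hδ₁ (div_pos hρpos hApos), fun c hc r hr hrρ ↦ ?_⟩
  have hrδ₁ : r ≤ δ₁ := hrρ.trans (min_le_left _ _)
  have hrA : A * r ≤ ρ := by
    have : r ≤ ρ / A := hrρ.trans (min_le_right _ _)
    rwa [le_div_iff₀ hApos, mul_comm] at this
  -- the source ball lies in `K₁ ⊆ D`
  have hBK₁ : ball c r ⊆ K₁ :=
    (ball_subset_closedBall.trans (closedBall_subset_closedBall hrδ₁)).trans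
      (closedBall_subset_cthickening hc δ₁)
  have hBD : ball c r ⊆ D := hBK₁.trans hK₁D
  -- the target ball `S = B(τ c, ρ) ⊆ K₂ ⊆ D'`
  have hτc' : τ c ∈ τ '' K₁ := ⟨c, self_subset_cthickening K hc, rfl⟩
  set S := ball (τ c) ρ with hS
  have hSK₂ : S ⊆ K₂ :=
    (ball_subset_closedBall.trans (closedBall_subset_closedBall hρδ₂)).trans
      (closedBall_subset_cthickening hτc' δ₂)
  have hSD' : S ⊆ D' := hSK₂.trans hK₂D
  -- `τ(B(c, r)) ⊆ S` by the mean value inequality for `τ` on the convex ball `B(c, r) ⊆ K₁`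
  have hτB : τ '' ball c r ⊆ S := by
    rintro _ ⟨x, hx, rfl⟩
    rw [hS, mem_ball, dist_eq_norm]
    have hmv : ‖τ x - τ c‖ ≤ A * ‖x - c‖ :=
      (convex_ball c r).norm_image_sub_le_of_norm_fderiv_le
        (fun z hz ↦ hτ1.differentiableAt (hD.mem_nhds (hBD hz)))
        (fun z hz ↦ hAb z (hBK₁ hz)) (mem_ball_self hr) hx
    calc ‖τ x - τ c‖ ≤ A * ‖x - c‖ := hmv
      _ < A * r := by
          gcongr
          rwa [← dist_eq_norm, ← mem_ball]
      _ ≤ ρ := hrA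
  -- on `S`: `g` maps into `K₁` (mean value for `g` on the convex `S ⊆ K₂`), with `‖g y - c‖ ≤ L ρ`
  have hgc : g (τ c) = c := hgτ c (hKD hc)
  have hm : ∀ y ∈ S, ‖g y - c‖ ≤ L * ρ := fun y hy ↦ by
    have hmv : ‖g y - g (τ c)‖ ≤ L * ‖y - τ c‖ :=
      (convex_ball (τ c) ρ).norm_image_sub_le_of_norm_fderiv_le
        (fun z hz ↦ hg1.differentiableAt (hD'.mem_nhds (hSD' hz)))
        (fun z hz ↦ hLb z (hSK₂ hz)) (mem_ball_self hρpos) hy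
    rw [hgc] at hmv
    refine hmv.trans ?_
    gcongr
    rw [← dist_eq_norm]
    exact (mem_ball.1 hy).le
  have hgK₁ : ∀ y ∈ S, g y ∈ K₁ := fun y hy ↦ by
    refine closedBall_subset_cthickening hc δ₁ ?_
    rw [mem_closedBall, dist_eq_norm]
    exact (hm y hy).trans hρδ₁
  -- the injectivity constant `σ = 1/A` of `Dg` on `S`
  have hσ : ∀ y ∈ S, ∀ v : V, 1 / A * ‖v‖ ≤ ‖fderiv ℝ g y v‖ := fun y hy v ↦ by
    have h := norm_le_norm_fderiv_mul hD hD' hτ1 hg1 hgD hτg (hSD' hy) v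
    rw [div_mul_eq_mul_div, one_mul, div_le_iff₀ hApos]
    calc ‖v‖ ≤ ‖fderiv ℝ τ (g y)‖ * ‖fderiv ℝ g y v‖ := h
      _ ≤ A * ‖fderiv ℝ g y v‖ := by gcongr; exact hAb _ (hgK₁ y hy)
      _ = ‖fderiv ℝ g y v‖ * A := mul_comm _ _
  refine ⟨hBD, ?_⟩
  exact convex_image_ball_of_bounds (Ω := D') (D := D) hD' hg (convex_ball (τ c) ρ) isOpen_ball hSD'
    (σ := 1 / A) (C := C) (m := L * ρ) (by positivity) hσ (fun y hy ↦ hCb y (hSK₂ hy)) hm hρσ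
    hr.le hgτ (fun y hy ↦ hτg y (hSD' hy)) hBD hτB

end Uniform

end Literature.Analysis.Convexity
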